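import Summits.Schanuel.Schanuel.Theorems.DiophantineDichotomyApproximationPropertyOrbitDichotomy
import Summits.Schanuel.Schanuel.Theorems.DiophantineDichotomyApproximationPropertyDescentCut
import Literature.NumberTheory.Transcendental.NesterenkoEliminationFacts2Proofs
import Literature.NumberTheory.Transcendental.NesterenkoHilbertBound
import Literature.NumberTheory.Transcendental.RoySmallValueFactors
import Literature.NumberTheory.Transcendental.PhilipponCriterionPrincipal
import HarnessLib

/-!
# Stub plan `CycleAPIAt3`, P3′ lemmas (IV): Bézout for an orbit on a curve, least forms, counting (towards `stub_satelliteHeight`)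

Crux `stmt-Schanuel-6117` (`Summit.Schanuel.Schanuel.Theses.DiophantineDichotomy.ApproximationProperty`),
route `DiophantineDichotomy`, line `orbit-interpolation-determinant`, registered stub
`stub_satelliteHeight : SatelliteHeight` (vocabulary `…CycleAPIAt3Defs.lean`: a `ℚ`-curve `V(𝔮)`
of degree `δ` through a Galois orbit `V(𝔭)` of `D > 2δ²` points has `h(𝔮) ≤ C(δ)(h(𝔭)/D + 1)`).
This file supplies the GEOMETRIC half of that stub (the arithmetic half — small forms through the
orbit — is `…SatelliteHeightOrbitForms.lean`):

* `orbit_form_mem_curve` (registered sub-goal) — **Bézout for an orbit on a curve**: a form of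
  degree `ν` with `ν · deg 𝔮 < D` vanishing on the orbit vanishes on the whole curve,
  `G ∈ 𝔭 ⇒ G ∈ 𝔮`. Otherwise LNM 1752 Ch. 3 Prop. 4.11 cuts `𝔮` by `G` to an unmixed `J` of rank `1`
  with `V(J) = V(𝔮) ∩ V(G) ∋` a point of the orbit and `deg J ≤ ν deg 𝔮`; the whole orbit then lies
  on the prime component of `J` through that point (`orbit_subset_projZeros_of_meets`), which is
  therefore `𝔭` (projective Nullstellensatz, equal ranks), and `D = deg 𝔭 ≤ deg J` by Prop. 4.7;
* `SatelliteHeightBezout.exists_isLeastForm`, `irreducible_of_isLeastForm` — a non-zero form of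
  least degree in a homogeneous prime is irreducible (adapted from
  `Literature/Barriers/Schanuel/NesterenkoModularScopeHolds.lean`, there for `ℚ[x₀, …, x₄]`);
* `SatelliteHeightBezout.exists_form_of_degree`, `exists_second_form` — counting in `ℙ³` with
  Nesterenko's Hilbert-function bound `H(𝔮; ν) ≤ deg 𝔮 (ν + 1)` (LNM 1752 Ch. 10 Lemma 3.1,
  `Nesterenko.hilbert_le_of_isPrime`): a prime curve of degree `δ` contains a non-zero form of
  degree `δ`, and its forms of degree `2δ` are not all multiples of a given form;
* `SatelliteHeightBezout.iheight_le_of_two_forms` — `h(𝔮)` for a prime curve `𝔮 ∋ G₁, G₂` of `ℙ³`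
  with `(G₁)` prime and `G₂ ∉ (G₁)`: `h(𝔮) ≤ (h(G₁) + 9 deg G₁) deg G₂ + h(G₂) deg G₁ +
  21 deg G₁ deg G₂` (Prop. 4.8 for `(G₁)`, Prop. 4.11 for the cut by `G₂`, Prop. 4.7 for the
  component `𝔮` of the cut: `PhilipponMain.cut_component_facts`).

No definitions. Sources: NesterenkoPhilippon2001 (LNM 1752) Ch. 3 Prop. 4.7, 4.8, 4.11, 4.13
(pp. 39–41), Ch. 10 Lemma 3.1–3.2 and proof of Prop. 3.6 (pp. 153–157).
-/

noncomputable section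

-- `Summit.Schanuel.Schanuel.…` is the mandated summit/sub-problem namespace (single-conjunct summit), hence:
set_option linter.dupNamespace false

namespace Summit.Schanuel.Schanuel.Cruxes.ApproximationProperty.OrbitInterpolationDeterminant

open Literature.NumberTheory.Transcendental Literature.NumberTheory.Transcendental.Nesterenko
open Literature.NumberTheory.Transcendental.PhilipponMain MvPolynomial
open scoped BigOperators

/-- **Registered sub-goal `orbit_form_mem_curve`** (aux for `stub_satelliteHeight`): Bézout for an
orbit on a curve. Let `𝔮 ⊆ 𝔭 ⊂ ℚ[x₀, …, x_m]` (`m ≥ 2`) be homogeneous primes of ranks `2` and `1`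
(a curve through a Galois orbit of `D = deg 𝔭` points) and `G ∈ 𝔭` a form of degree `ν ≥ 1` with
`ν · deg 𝔮 < D`. Then `G ∈ 𝔮`. [cite: NesterenkoPhilippon2001, Ch. 3 Prop. 4.11 and Prop. 4.7 (pp. 39–41)] -/
theorem orbit_form_mem_curve : ∀ (m : ℕ) (𝔭 𝔮 : Ideal (Rx m)) (ν : ℕ) (G : Rx m), 2 ≤ m → 𝔭.IsPrime → (letI := MvPolynomial.gradedAlgebra (σ := Fin (m + 1)) (R := ℚ); 𝔭.IsHomogeneous (homogeneousSubmodule (Fin (m + 1)) ℚ)) → IsUnmixedOfRank 𝔭 1 → 𝔮.IsPrime → (letI := MvPolynomial.gradedAlgebra (σ := Fin (m + 1)) (R := ℚ); 𝔮.IsHomogeneous (homogeneousSubmodule (Fin (m + 1)) ℚ)) → IsUnmixedOfRank 𝔮 2 → 𝔮 ≤ 𝔭 → 1 ≤ ν → G.IsHomogeneous ν → ideg 𝔮 2 * ν < ideg 𝔭 1 → G ∈ 𝔭 → G ∈ 𝔮 := by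
  intro m 𝔭 𝔮 ν G hm h𝔭 h𝔭hom h𝔭unm h𝔮 h𝔮hom h𝔮unm hle hν hG hlt hG𝔭
  classical
  letI := MvPolynomial.gradedAlgebra (σ := Fin (m + 1)) (R := ℚ)
  by_contra hG𝔮
  have h411 := NesterenkoPhilippon2001_ch3_prop_4_11_holds
  have h47 := NesterenkoPhilippon2001_ch3_prop_4_7_holds
  have h413 := NesterenkoPhilippon2001_ch3_prop_4_13_holds
  obtain ⟨J, hJhom, hJunm, hJV, hJdeg, -, -⟩ :=
    (h411 m 2 𝔮 G ν (by norm_num) hm h𝔮 h𝔮hom h𝔮unm hG hν hG𝔮).1 le_rfl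
  -- a point of the orbit, on `V(J) = V(𝔮) ∩ V(G)`
  have hω : (fun _ : Fin (m + 1) => (1 : ℂ)) ≠ 0 := fun h => one_ne_zero (congrFun h 0)
  obtain ⟨β, hβ, -⟩ := h413 m 1 𝔭 le_rfl (by omega) h𝔭hom h𝔭unm _ hω
  have hβJ : β ∈ projZeros J := by
    rw [hJV, projZeros_sup, projZeros_span_singleton]
    exact ⟨projZeros_antitone hle hβ, hβ.1, hβ.2 G hG𝔭⟩
  -- the prime component of `J` through `β`
  obtain ⟨t, ht⟩ : ∃ t : Finset (Ideal (Rx m)), Submodule.IsMinimalPrimaryDecomposition J t :=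
    Submodule.IsLasker.exists_isMinimalPrimaryDecomposition (Submodule.isLasker _ _) J
  rw [projZeros_eq_biUnion_radical ht.inf_eq, Set.mem_iUnion₂] at hβJ
  obtain ⟨Q, hQt, hβQ⟩ := hβJ
  obtain ⟨hqprime, hqhom, hqunm, -, -⟩ :=
    Literature.Barriers.Schanuel.radical_component_facts hJhom hJunm ht hQt
  have hqc : ∀ P ∈ Q.radical, ∀ k : ℕ, homogeneousComponent k P ∈ Q.radical :=
    fun P hP k => homogeneousComponent_mem_of_mem hqhom hP k
  -- the whole orbit lies on it, so it is `𝔭`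
  have hsub : projZeros 𝔭 ⊆ projZeros Q.radical :=
    orbit_subset_projZeros_of_meets m 𝔭 Q.radical (by omega) h𝔭 h𝔭hom h𝔭unm hqc ⟨β, hβ, hβQ⟩
  have hQle : Q.radical ≤ 𝔭 := le_of_projZeros_subset h𝔭 hqc hqprime.ne_top hsub
  have hQeq : Q.radical = 𝔭 := eq_of_le_of_isUnmixedOfRank hqprime h𝔭 hQle hqunm h𝔭unm
  -- degrees
  obtain ⟨hsum1, -, -⟩ := h47 m 1 J le_rfl (by omega) hJhom hJunm t ht β hβ.1
  have hk : ∀ Q' ∈ t, 1 ≤ primaryExponent Q' := fun Q' hQ' =>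
    (Literature.Barriers.Schanuel.radical_component_facts hJhom hJunm ht hQ').2.2.2.2
  have hdeg := ideg_radical_le hsum1 hk hQt
  rw [hQeq] at hdeg
  have hJdeg' : ideg J 1 ≤ ideg 𝔮 2 * ν := by simpa using hJdeg
  omega

namespace SatelliteHeightBezout

variable {m : ℕ}

/-! ## Least forms of a homogeneous prime (adapted from `NesterenkoModularScopeHolds.lean`) -/

/-- A non-zero form of least degree in a prime ideal of `ℚ[x̲]` is irreducible (divisors of forms
are forms). [cite: NesterenkoPhilippon2001, Ch. 10, proof of Prop. 3.6 (p. 157)] -/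
theorem irreducible_of_isLeastForm {𝔭 : Ideal (Rx m)} (hprime : 𝔭.IsPrime) {E : Rx m} {L : ℕ}
    (hE : E ∈ 𝔭) (hE0 : E ≠ 0) (hEL : E.IsHomogeneous L)
    (hmin : ∀ P ∈ 𝔭, P ≠ 0 → ∀ d, P.IsHomogeneous d → L ≤ d) : Irreducible E := by
  -- adapted from Literature/Barriers/Schanuel/NesterenkoModularScopeHolds.lean (`m = 4` there)
  have key : ∀ a b : Rx m, E = a * b → a ∈ 𝔭 → IsUnit b := by
    intro a b hab ha
    have ha0 : a ≠ 0 := by rintro rfl; exact hE0 (by rw [hab, zero_mul])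
    have hb0 : b ≠ 0 := by rintro rfl; exact hE0 (by rw [hab, mul_zero])
    have hahom := Roy2013.isHomogeneous_of_dvd hEL hE0 ⟨b, hab⟩
    have hbhom := Roy2013.isHomogeneous_of_dvd hEL hE0 ⟨a, hab.trans (mul_comm a b)⟩
    have hsum : a.totalDegree + b.totalDegree = L := by
      have h := hahom.mul hbhom
      rw [← hab] at h
      exact h.inj_right hEL hE0
    have hLa : L ≤ a.totalDegree := hmin a ha ha0 _ hahom
    have hb : b.totalDegree = 0 := by omega
    rw [totalDegree_eq_zero_iff_eq_C] at hb
    rw [hb]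
    refine IsUnit.map C (Ne.isUnit ?_)
    intro h0
    exact hb0 (by rw [hb, h0, C_0])
  refine irreducible_iff.mpr ⟨fun hu => hprime.ne_top (Ideal.eq_top_of_isUnit_mem _ hE hu),
    fun a b hab => ?_⟩
  rcases hprime.mem_or_mem (show a * b ∈ 𝔭 by rw [← hab]; exact hE) with ha | hb
  · exact Or.inr (key a b hab ha)
  · exact Or.inl (key b a (hab.trans (mul_comm a b)) hb)

/-- A form of least degree in a proper homogeneous ideal containing a non-zero form: a non-zero
`E ∈ 𝔭`, homogeneous of degree `L ≥ 1`, every non-zero form of `𝔭` having degree `≥ L`.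
[cite: NesterenkoPhilippon2001, Ch. 10, proof of Prop. 3.6 (p. 157)] -/
theorem exists_isLeastForm {𝔭 : Ideal (Rx m)} (hnt : 𝔭 ≠ ⊤)
    (hex : ∃ d, ∃ P ∈ 𝔭, P ≠ 0 ∧ P.IsHomogeneous d) :
    ∃ (E : Rx m) (L : ℕ), E ∈ 𝔭 ∧ E ≠ 0 ∧ E.IsHomogeneous L ∧ 1 ≤ L ∧
      ∀ P ∈ 𝔭, P ≠ 0 → ∀ d, P.IsHomogeneous d → L ≤ d := by
  -- adapted from Literature/Barriers/Schanuel/NesterenkoModularScopeHolds.lean (`m = 4` there)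
  classical
  obtain ⟨E, hE, hE0, hEL⟩ := Nat.find_spec hex
  refine ⟨E, Nat.find hex, hE, hE0, hEL, ?_, fun P hP hP0 d hPd => Nat.find_min' hex ⟨P, hP, hP0, hPd⟩⟩
  by_contra h0
  have hL0 : Nat.find hex = 0 := by omega
  rw [hL0] at hEL
  have hdeg : E.totalDegree = 0 := hEL.totalDegree hE0
  rw [totalDegree_eq_zero_iff_eq_C] at hdeg
  refine hnt (Ideal.eq_top_of_isUnit_mem _ hE ?_)
  rw [hdeg]
  refine IsUnit.map C (Ne.isUnit ?_)
  intro hc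
  exact hE0 (by rw [hdeg, hc, C_0])

/-! ## Counting forms on a prime curve of `ℙ³` -/

/-- `6 · binom(n + 3, 3) = (n + 3)(n + 2)(n + 1)`. [folklore] -/
theorem six_mul_choose_three (n : ℕ) : 6 * (n + 3).choose 3 = (n + 3) * (n + 2) * (n + 1) := by
  have h1 : (n + 2 + 1) * (n + 2).choose 2 = (n + 2 + 1).choose (2 + 1) * (2 + 1) :=
    Nat.add_one_mul_choose_eq (n + 2) 2
  have h2 : (n + 1 + 1) * (n + 1).choose 1 = (n + 1 + 1).choose (1 + 1) * (1 + 1) :=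
    Nat.add_one_mul_choose_eq (n + 1) 1
  simp only [Nat.choose_one_right] at h2
  have h1' : (n + 3) * (n + 2).choose 2 = (n + 3).choose 3 * 3 := h1
  have h2' : (n + 2) * (n + 1) = (n + 2).choose 2 * 2 := h2
  nlinarith [h1', h2']

/-- An ideal with a non-zero projective zero misses some variable. [folklore] -/
theorem exists_X_notMem {𝔮 : Ideal (Rx m)} (hne : (projZeros 𝔮).Nonempty) : ∃ j, (X j : Rx m) ∉ 𝔮 := by
  obtain ⟨β, hβ0, hβ⟩ := hne
  by_contra hall
  push Not at hall
  exact hβ0 (funext fun j => by simpa using hβ (X j) (hall j))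

variable {𝔮 : Ideal (Rx 3)}

/-- A prime curve `V(𝔮) ⊂ ℙ³` of degree `δ` lies on a surface of degree `δ`: `𝔮_δ ≠ 0`
(`binom(δ + 3, 3) > δ(δ + 1) ≥ H(𝔮; δ)`). [cite: NesterenkoPhilippon2001, Ch. 10 Lemma 3.2 (p. 153)] -/
theorem exists_form_of_degree (h𝔮 : 𝔮.IsPrime)
    (hhom : letI := MvPolynomial.gradedAlgebra (σ := Fin (3 + 1)) (R := ℚ);
      𝔮.IsHomogeneous (homogeneousSubmodule (Fin (3 + 1)) ℚ))
    (hdim : ringKrullDim (Rx 3 ⧸ 𝔮) = (2 : ℕ)) (hne : (projZeros 𝔮).Nonempty) :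
    ∃ P ∈ 𝔮, P.IsHomogeneous (ideg 𝔮 2) ∧ P ≠ 0 := by
  letI := MvPolynomial.gradedAlgebra (σ := Fin (3 + 1)) (R := ℚ)
  obtain ⟨j, hj⟩ := exists_X_notMem hne
  refine exists_isHomogeneous_mem_ne_zero_of_isPrime h𝔮 hhom (s := 1) hdim hj ?_
  have h6 := six_mul_choose_three (ideg 𝔮 2)
  have h1 : 6 * (ideg 𝔮 2 * (ideg 𝔮 2 + 1)) < 6 * (ideg 𝔮 2 + 3).choose 3 := by
    rw [h6]; nlinarith [Nat.zero_le (ideg 𝔮 2), sq_nonneg (ideg 𝔮 2)]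
  have h2 : ideg 𝔮 2 * (ideg 𝔮 2 + 1) < (ideg 𝔮 2 + 3).choose 3 := by omega
  rw [Nat.choose_symm_add]
  simpa using h2

/-- **The forms of degree `2δ` on a prime curve of degree `δ` in `ℙ³` are not all multiples of one
form `G₁` of degree `≥ 1`**: `dim 𝔮_{2δ} ≥ binom(2δ+3, 3) − δ(2δ+1) > binom(2δ+2, 3) ≥ dim (G₁)_{2δ}`.
So a set spanning `𝔮_{2δ}` has a member outside `(G₁)`. [cite: NesterenkoPhilippon2001, Ch. 10 Lemma 3.1 (p. 153)] -/
theorem exists_second_form (h𝔮 : 𝔮.IsPrime)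
    (hhom : letI := MvPolynomial.gradedAlgebra (σ := Fin (3 + 1)) (R := ℚ);
      𝔮.IsHomogeneous (homogeneousSubmodule (Fin (3 + 1)) ℚ))
    (hdim : ringKrullDim (Rx 3 ⧸ 𝔮) = (2 : ℕ)) (hne : (projZeros 𝔮).Nonempty)
    {G₁ : Rx 3} {ν₁ : ℕ} (hG₁ : G₁.IsHomogeneous ν₁) (hν₁ : 1 ≤ ν₁) (hν₁δ : ν₁ ≤ 2 * ideg 𝔮 2)
    (hG₁0 : G₁ ≠ 0) {s : Finset (Rx 3)}
    (hspan : ∀ P ∈ 𝔮, P.IsHomogeneous (2 * ideg 𝔮 2) → P ∈ Submodule.span ℚ (s : Set (Rx 3))) :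
    ∃ G₂ ∈ s, G₂ ∉ Ideal.span {G₁} := by
  classical
  letI := MvPolynomial.gradedAlgebra (σ := Fin (3 + 1)) (R := ℚ)
  by_contra hall
  push Not at hall
  -- `𝔮_{2δ} ⊆ (G₁)_{2δ}`
  have hsub : Literature.RingTheory.MvPolynomial.idealDegree 𝔮 (2 * ideg 𝔮 2) ≤
      Literature.RingTheory.MvPolynomial.idealDegree (Ideal.span {G₁}) (2 * ideg 𝔮 2) := by
    intro P hP
    refine ⟨?_, hP.2⟩
    have hle : Submodule.span ℚ (s : Set (Rx 3)) ≤ (Ideal.span {G₁}).restrictScalars ℚ :=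
      Submodule.span_le.mpr fun G hG => hall G (Finset.mem_coe.mp hG)
    exact hle (hspan P hP.1 hP.2)
  have hfin := Submodule.finrank_mono hsub
  -- `dim (G₁)_{2δ} = binom(2δ - ν₁ + 3, 3)`
  obtain ⟨j, hj⟩ := exists_X_notMem hne
  have hspan_hom : (Ideal.span {G₁}).IsHomogeneous (homogeneousSubmodule (Fin (3 + 1)) ℚ) :=
    Ideal.homogeneous_span _ _ fun x hx => by
      rw [Set.mem_singleton_iff.mp hx]; exact ⟨ν₁, (mem_homogeneousSubmodule ν₁ G₁).mpr hG₁⟩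
  have hdimG : Module.finrank ℚ (Literature.RingTheory.MvPolynomial.idealDegree (Ideal.span {G₁})
      (2 * ideg 𝔮 2)) = (2 * ideg 𝔮 2 - ν₁ + 3).choose 3 := by
    have h := Literature.RingTheory.MvPolynomial.idealDegree_sup_span_singleton
      (I := (⊥ : Ideal (Rx 3))) (fun i x hx => by
        rw [Ideal.mem_bot] at hx; subst hx; simp) hG₁ (2 * ideg 𝔮 2 - ν₁)
    rw [bot_sup_eq, Nat.sub_add_cancel hν₁δ, Literature.RingTheory.MvPolynomial.idealDegree_bot,
      bot_sup_eq] at h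
    haveI := Literature.RingTheory.MvPolynomial.finite_homogeneousSubmodule (K := ℚ)
      (σ := Fin (3 + 1)) (2 * ideg 𝔮 2 - ν₁)
    rw [h, Literature.RingTheory.MvPolynomial.finrank_map_mulLeft hG₁0,
      finrank_homogeneousSubmodule_eq 3 (2 * ideg 𝔮 2 - ν₁), Nat.choose_symm_add]
  -- Hilbert bound for `𝔮`
  have hH := hilbert_le_of_isPrime h𝔮 hhom (s := 1) hdim hj (2 * ideg 𝔮 2)
  rw [finrank_homogeneousSubmodule_eq 3 (2 * ideg 𝔮 2), Nat.choose_symm_add] at hH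
  have hH' : (2 * ideg 𝔮 2 + 3).choose 3 ≤ ideg 𝔮 2 * (2 * ideg 𝔮 2 + 1) +
      Module.finrank ℚ (Literature.RingTheory.MvPolynomial.idealDegree 𝔮 (2 * ideg 𝔮 2)) := by
    have := Nat.sub_le_iff_le_add.mp hH
    simpa using this
  rw [hdimG] at hfin
  -- numerics
  have hmono : (2 * ideg 𝔮 2 - ν₁ + 3).choose 3 ≤ (2 * ideg 𝔮 2 + 2).choose 3 :=
    Nat.choose_le_choose 3 (by omega)
  have hpascal : (2 * ideg 𝔮 2 + 3).choose 3 =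
      (2 * ideg 𝔮 2 + 2).choose 2 + (2 * ideg 𝔮 2 + 2).choose 3 :=
    Nat.choose_succ_succ (2 * ideg 𝔮 2 + 2) 2
  have htwo : (2 * ideg 𝔮 2 + 2).choose 2 * 2 = (2 * ideg 𝔮 2 + 2) * (2 * ideg 𝔮 2 + 1) := by
    have h : (2 * ideg 𝔮 2 + 1 + 1) * (2 * ideg 𝔮 2 + 1).choose 1 =
        (2 * ideg 𝔮 2 + 1 + 1).choose (1 + 1) * (1 + 1) := Nat.add_one_mul_choose_eq _ 1
    simp only [Nat.choose_one_right] at h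
    linarith
  have key' : (2 * ideg 𝔮 2 + 2).choose 2 ≤ ideg 𝔮 2 * (2 * ideg 𝔮 2 + 1) := by omega
  nlinarith [key', htwo]

/-! ## The height of a prime curve from two forms through it -/

/-- **`h(𝔮)` from two forms.** Let `𝔮 ⊂ ℚ[x₀, …, x₃]` be a prime of rank `2` with
`V(𝔮) ≠ ∅`, `G₁ ∈ 𝔮` a non-zero form of degree `ν₁` generating a PRIME ideal, `G₂ ∈ 𝔮 ∖ (G₁)` a form of
degree `ν₂ ≥ 1`. Then `h(𝔮) ≤ (h(G₁) + 9ν₁) ν₂ + h(G₂) ν₁ + 21 ν₁ ν₂`: `𝔮` is a prime component of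
Prop. 4.11's cut of `(G₁)` (Prop. 4.8: `deg (G₁) = ν₁`, `h((G₁)) ≤ h(G₁) + 9ν₁`) by `G₂`, and
components inherit the bounds (Prop. 4.7, `PhilipponMain.cut_component_facts`).
[cite: NesterenkoPhilippon2001, Ch. 3 Prop. 4.7, 4.8, 4.11 (pp. 39–41)] -/
theorem iheight_le_of_two_forms (h𝔮 : 𝔮.IsPrime)
    (hunm : IsUnmixedOfRank 𝔮 2) (hne : (projZeros 𝔮).Nonempty)
    {G₁ G₂ : Rx 3} {ν₁ ν₂ : ℕ} (hG₁ : G₁.IsHomogeneous ν₁) (hG₁0 : G₁ ≠ 0)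
    (hP₁ : (Ideal.span {G₁}).IsPrime) (hG₁𝔮 : G₁ ∈ 𝔮)
    (hG₂ : G₂.IsHomogeneous ν₂) (hν₂ : 1 ≤ ν₂) (hG₂𝔮 : G₂ ∈ 𝔮) (hG₂n : G₂ ∉ Ideal.span {G₁}) :
    iheight 𝔮 2 ≤ (height G₁ + 9 * ν₁) * ν₂ + height G₂ * ν₁ + 21 * ν₁ * ν₂ := by
  classical
  letI := MvPolynomial.gradedAlgebra (σ := Fin (3 + 1)) (R := ℚ)
  have h411 := NesterenkoPhilippon2001_ch3_prop_4_11_holds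
  have h47 := NesterenkoPhilippon2001_ch3_prop_4_7_holds
  have h48 := NesterenkoPhilippon2001_ch3_prop_4_8_holds
  set 𝔓 : Ideal (Rx 3) := Ideal.span {G₁} with h𝔓
  have h𝔓hom : 𝔓.IsHomogeneous (homogeneousSubmodule (Fin (3 + 1)) ℚ) :=
    Ideal.homogeneous_span _ _ fun x hx => by
      rw [Set.mem_singleton_iff.mp hx]; exact ⟨ν₁, (mem_homogeneousSubmodule ν₁ G₁).mpr hG₁⟩
  have hG₁u : ¬ IsUnit G₁ := fun hu => hP₁.ne_top ((Ideal.span_singleton_eq_top).mpr hu)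
  have h𝔓unm : IsUnmixedOfRank 𝔓 3 := isUnmixedOfRank_span_singleton hG₁0 hG₁u
  have hω : (fun _ : Fin (3 + 1) => (1 : ℂ)) ≠ 0 := fun h => one_ne_zero (congrFun h 0)
  obtain ⟨hdeg𝔓, hh𝔓, -⟩ := h48 3 G₁ ν₁ (by norm_num) hG₁0 hG₁ h𝔓unm _ hω
  -- the cut of `(G₁)` by `G₂` and its component `𝔮`
  obtain ⟨J, hJhom, hJunm, hJV, -, -, -⟩ :=
    (h411 3 3 𝔓 G₂ ν₂ (by norm_num) le_rfl hP₁ h𝔓hom h𝔓unm hG₂ hν₂ hG₂n).1 (by norm_num)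
  obtain ⟨t, ht⟩ : ∃ t : Finset (Ideal (Rx 3)), Submodule.IsMinimalPrimaryDecomposition J t :=
    Submodule.IsLasker.exists_isMinimalPrimaryDecomposition (Submodule.isLasker _ _) J
  have hQ'facts := fun (Q' : Ideal (Rx 3)) (hQ' : Q' ∈ t) =>
    Literature.Barriers.Schanuel.radical_component_facts hJhom hJunm ht hQ'
  have h𝔮V : projZeros 𝔮 ⊆ ⋃ Q' ∈ t, projZeros Q'.radical := by
    rw [← projZeros_eq_biUnion_radical ht.inf_eq, hJV]
    exact projZeros_antitone (sup_le ((Ideal.span_singleton_le_iff_mem _).mpr hG₁𝔮)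
      ((Ideal.span_singleton_le_iff_mem _).mpr hG₂𝔮))
  obtain ⟨Q, hQt, hQle⟩ := exists_le_of_projZeros_subset_biUnion (s := t)
    (𝔭 := fun Q' : Ideal (Rx 3) => Q'.radical) h𝔮
    (fun Q' hQ' => fun g hg k => homogeneousComponent_mem_of_mem (hQ'facts Q' hQ').2.1 hg k)
    (fun Q' hQ' => (hQ'facts Q' hQ').1.ne_top) hne h𝔮V
  have heq : Q.radical = 𝔮 :=
    eq_of_le_of_isUnmixedOfRank (hQ'facts Q hQt).1 h𝔮 hQle (hQ'facts Q hQt).2.2.1 hunm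
  have hne' : (projZeros Q.radical).Nonempty := by rw [heq]; exact hne
  obtain ⟨-, -, -, hh⟩ := cut_component_facts h47 h411 (by norm_num : 2 ≤ 3) le_rfl hP₁ h𝔓hom h𝔓unm
    hG₂ hG₂n hJhom hJunm hJV ht hQt hne'
  rw [heq, hdeg𝔓] at hh
  have hν₁0 : (0 : ℝ) ≤ ν₁ := Nat.cast_nonneg _
  have hν₂0 : (0 : ℝ) ≤ ν₂ := Nat.cast_nonneg _
  have hG₂h : 0 ≤ height G₂ := height_nonneg _
  calc iheight 𝔮 2 ≤ iheight 𝔓 3 * ν₂ + height G₂ * ν₁ + ((3 : ℝ) * (3 + 1) + (3 : ℝ) ^ 2) * ν₁ * ν₂ := by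
        simpa using hh
    _ ≤ (height G₁ + 9 * ν₁) * ν₂ + height G₂ * ν₁ + 21 * ν₁ * ν₂ := by
        have hh𝔓' : iheight 𝔓 3 ≤ height G₁ + 9 * ν₁ := by
          have h := hh𝔓; norm_num at h; exact h
        have h1 : iheight 𝔓 3 * ν₂ ≤ (height G₁ + 9 * ν₁) * ν₂ :=
          mul_le_mul_of_nonneg_right hh𝔓' hν₂0
        nlinarith [h1, mul_nonneg hν₁0 hν₂0]

end SatelliteHeightBezout

end Summit.Schanuel.Schanuel.Cruxes.ApproximationProperty.OrbitInterpolationDeterminant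

end
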